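import Mathlib
import Literature.Probability.Percolation.DiagonalStripPairingClosedForm
import HarnessLib

/-!
# The ground state of `t(w; z⃗)` does not depend on the spectral parameter `w`

Topic `Literature/Probability/Percolation`. Ikhlef–Ponsaing (J. Stat. Phys. 149 (2012),
arXiv:1202.5476) §3.4 identify the ground state of the transfer matrix `t(w; z_1, …, z_L)` with the
solution of the qKZ system (20)–(22), which does not involve `w` ("two transfer matrices with
different values of `w` commute", after [DF05]). This file proves the `w`-independence of the
primitive polynomial ground state `P` (`IsGroundState`, `DiagonalStripPairingPolynomial`) from the
uniqueness of the solution of the exact qKZ system (`qKZ_solution_eq_smul_groundState`,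
`DiagonalStripQKZUniqueness`): the shifted family `P(w+1; z⃗)` (`wShiftAlg`, `genWShift` on the
rapidity field, commuting with `σ_i`, `ι_k`, `i, k ≥ 1`) solves the same system, hence is a
rapidity-field multiple `c · P`; by primitivity of both families `c` is a nonzero constant, and a
polynomial with `F(w+1) = c F(w)` is constant in `w` (`degreeOf_zero_eq_zero_of_wShift`: leading
coefficients give `c = 1`, then `F` is `1`-periodic in `w`). Main results:
**`IsGroundState.degreeOf_zero`** (`deg_w P_Q = 0`) and **`IsGroundState.wfree`** (the `wfree` clause of
`GroundStateBounds`).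

## References

* Y. Ikhlef, A. K. Ponsaing, *Finite-size left-passage probability in percolation*, J. Stat. Phys.
  149 (2012) 10–36, arXiv:1202.5476, §3.4. [IkhlefPonsaing2012]
-/

namespace Literature.Probability.Percolation

open Finset Literature.Probability.LatticeModels Literature.Probability.LatticeModels.TemperleyLieb

section WShift

open MvPolynomial

/-- **The shift `w ↦ w + 1` as an algebra automorphism of `ℂ[X]`** (`X_0 ↦ X_0 + 1`). [folklore] -/
noncomputable def wShiftAlg : MvPolynomial ℕ ℂ ≃ₐ[ℂ] MvPolynomial ℕ ℂ :=
  AlgEquiv.ofAlgHom (substHom 0 (X 0 + 1)) (substHom 0 (X 0 - 1))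
    (by
      refine algHom_ext fun k => ?_
      by_cases hk : k = 0
      · subst hk; simp [substHom_X_self, map_sub]
      · simp [substHom_X_of_ne _ hk])
    (by
      refine algHom_ext fun k => ?_
      by_cases hk : k = 0
      · subst hk; simp [substHom_X_self, map_add]
      · simp [substHom_X_of_ne _ hk])

/-- `wShiftAlg F = F(X_0 ↦ X_0 + 1)`. [folklore] -/
theorem wShiftAlg_apply (F : MvPolynomial ℕ ℂ) : wShiftAlg F = substHom 0 (X 0 + 1) F := rfl

/-- **The shift on the rapidity field.** [folklore] -/
noncomputable def genWShift : RapidityField ℂ ≃+* RapidityField ℂ :=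
  IsFractionRing.ringEquivOfRingEquiv wShiftAlg.toRingEquiv

/-- The shift on polynomials. [folklore] -/
theorem genWShift_toRF (F : MvPolynomial ℕ ℂ) : genWShift (toRF ℂ F) = toRF ℂ (substHom 0 (X 0 + 1) F) :=
  IsFractionRing.ringEquivOfRingEquiv_algebraMap _ F

/-- The shift fixes `z_k`, `k ≥ 1`. [folklore] -/
theorem genWShift_genZ {k : ℕ} (hk : k ≠ 0) : genWShift (genZ ℂ k) = genZ ℂ k := by
  rw [show genZ ℂ k = toRF ℂ (X k) from rfl, genWShift_toRF, substHom_X_of_ne _ hk]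

/-- The shift fixes constants. [folklore] -/
theorem genWShift_genC (a : ℂ) : genWShift (genC ℂ a) = genC ℂ a := by
  rw [show genC ℂ a = toRF ℂ (C a) from rfl, genWShift_toRF, substHom_C]

/-- The shift on `w`. [folklore] -/
theorem genWShift_genW : genWShift (genW ℂ) = genW ℂ + 1 := by
  rw [show genW ℂ = toRF ℂ (X 0) from rfl, genWShift_toRF, substHom_X_self, map_add, map_one]

/-- **The shift commutes with the swaps `σ_i`, `i ≥ 1`.** [folklore] -/
theorem genWShift_genSwap {i : ℕ} (hi : 1 ≤ i) (x : RapidityField ℂ) :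
    genWShift (genSwap ℂ i x) = genSwap ℂ i (genWShift x) := by
  have : (genWShift.toRingHom).comp (genSwap ℂ i).toRingHom = (genSwap ℂ i).toRingHom.comp genWShift.toRingHom := by
    refine rapidityField_ringHom_ext (fun a => ?_) (fun n => ?_)
    · simp only [RingHom.comp_apply, RingEquiv.toRingHom_eq_coe, RingHom.coe_coe]
      rw [show genC ℂ a = toRF ℂ (C a) from rfl, genSwap_toRF, rename_C, genWShift_toRF, substHom_C, genSwap_toRF, rename_C]
    · simp only [RingHom.comp_apply, RingEquiv.toRingHom_eq_coe, RingHom.coe_coe]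
      by_cases hn : n = 0
      · subst hn
        rw [show genZ ℂ 0 = genW ℂ from rfl, genSwap_genW (by omega), genWShift_genW, map_add, map_one, genSwap_genW (by omega)]
      · rw [genWShift_genZ hn, show genZ ℂ n = toRF ℂ (X n) from rfl, genSwap_toRF, rename_X]
        rw [show toRF ℂ (X (Equiv.swap i (i + 1) n)) = genZ ℂ (Equiv.swap i (i + 1) n) from rfl, genWShift_genZ]
        rw [Equiv.swap_apply_def]; split_ifs <;> omega
  exact RingHom.congr_fun this x

/-- **The shift commutes with the inversions `ι_k`, `k ≥ 1`.** [folklore] -/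
theorem genWShift_genInv {k : ℕ} (hk : k ≠ 0) (x : RapidityField ℂ) :
    genWShift (genInv ℂ k x) = genInv ℂ k (genWShift x) := by
  have : (genWShift.toRingHom).comp (genInv ℂ k) = (genInv ℂ k).comp genWShift.toRingHom := by
    refine rapidityField_ringHom_ext (fun a => ?_) (fun n => ?_)
    · simp only [RingHom.comp_apply, RingEquiv.toRingHom_eq_coe, RingHom.coe_coe, genInv_genC, genWShift_genC]
    · simp only [RingHom.comp_apply, RingEquiv.toRingHom_eq_coe, RingHom.coe_coe]
      by_cases hn : n = 0
      · subst hn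
        rw [show genZ ℂ 0 = genW ℂ from rfl, genInv_genW hk, genWShift_genW, map_add, map_one, genInv_genW hk]
      · rw [genWShift_genZ hn, genInv_genZ]
        by_cases hnk : n = k
        · subst hnk; rw [Function.update_self, map_inv₀, genWShift_genZ hn]
        · rw [Function.update_of_ne hnk, genWShift_genZ hn]
  exact RingHom.congr_fun this x

variable {n : ℕ} {q : ℂ}

/-- **The exact exchange relations are transported by the shift.** [folklore] -/
theorem IsExactExchange.wShift {i : ℕ} (hi : 1 ≤ i) {g : ColPattern n → ColPattern n} {ψ : ColPattern n → RapidityField ℂ}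
    (hex : IsExactExchange q i g ψ) : IsExactExchange q i g (fun Q => genWShift (ψ Q)) := by
  intro Q
  have h := congrArg genWShift (hex Q)
  have hpush : genWShift (ipPush g ψ Q) = ipPush g (fun Q => genWShift (ψ Q)) Q := by unfold ipPush; rw [map_sum]
  rw [map_sub, map_mul, map_mul, map_mul, hpush, genWShift_genSwap hi] at h
  have hz : ∀ k, 1 ≤ k → genWShift (genZ ℂ k) = genZ ℂ k := fun k hk => genWShift_genZ (by omega)
  have hqbr : ∀ x, genWShift (qbr x) = qbr (genWShift x) := fun x => by unfold qbr; rw [map_sub, map_inv₀]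
  simp only [hqbr, map_mul, map_div₀, genWShift_genC, hz i hi, hz (i + 1) (by omega)] at h
  exact h

namespace IsGroundState

variable {P : ColPattern n → MvPolynomial ℕ ℂ} {a : ℤ}

/-- **The shifted ground state is a rapidity-field multiple of the ground state** (qKZ uniqueness).
[cite: IkhlefPonsaing2012, §3.4] -/
theorem exists_wShift_eq_smul (hq : q ^ 2 + q + 1 = 0) (h : IsGroundState n q P a) :
    ∃ c : RapidityField ℂ, ∀ Q, toRF ℂ (substHom 0 (X 0 + 1) (P Q)) = c * toRF ℂ (P Q) := by
  have key := qKZ_solution_eq_smul_groundState hq h.prim h.fixed h.odd h.even h.top h.bot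
    (ψ' := fun Q => genWShift (toRF ℂ (P Q)))
    (fun Q hQ => h.supp hq Q fun h0 => hQ (by simp only [h0, map_zero]))
    (fun j' => (h.odd j').wShift (by omega)) (fun b0 => (h.even b0).wShift (by omega))
    (fun Q => by
      show genInv ℂ 1 (genWShift (toRF ℂ (P Q))) = _
      rw [← genWShift_genInv one_ne_zero, h.bot Q, map_mul, map_zpow₀, genWShift_genZ one_ne_zero])
    (fun Q => by
      show genInv ℂ (2 * n + 1) (genWShift (toRF ℂ (P Q))) = _
      rw [← genWShift_genInv (by omega), h.top Q, map_mul, map_zpow₀, genWShift_genZ (by omega)])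
  obtain ⟨c, hc⟩ := key
  exact ⟨c, fun Q => by rw [← genWShift_toRF]; exact hc Q⟩

/-- The shifted family is primitive. [folklore] -/
theorem wShift_prim (h : IsGroundState n q P a) : PolyPrimitive fun Q => substHom 0 (X 0 + 1) (P Q) := by
  intro d hd
  have hd' : ∀ Q, wShiftAlg.symm d ∣ P Q := fun Q => by
    have h1 : d ∣ wShiftAlg (P Q) := hd Q
    have := map_dvd (wShiftAlg.symm : MvPolynomial ℕ ℂ ≃ₐ[ℂ] MvPolynomial ℕ ℂ) h1
    rwa [AlgEquiv.symm_apply_apply] at this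
  have hu := h.prim _ hd'
  have := hu.map (wShiftAlg : MvPolynomial ℕ ℂ ≃ₐ[ℂ] MvPolynomial ℕ ℂ)
  rwa [AlgEquiv.apply_symm_apply] at this

/-- **The shifted ground state is a constant multiple of the ground state.** [folklore] -/
theorem exists_wShift_eq_C_mul (hq : q ^ 2 + q + 1 = 0) (h : IsGroundState n q P a) :
    ∃ c : ℂ, c ≠ 0 ∧ ∀ Q, substHom 0 (X 0 + 1) (P Q) = C c * P Q := by
  obtain ⟨c, hc⟩ := h.exists_wShift_eq_smul hq
  obtain ⟨C₀, hC₀⟩ := h.prim.exists_eq_toRF (c := c) fun Q => ⟨_, (hc Q).symm⟩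
  have hpoly : ∀ Q, substHom 0 (X 0 + 1) (P Q) = C₀ * P Q := fun Q =>
    toRF_injective (by rw [hc Q, hC₀, map_mul])
  -- `C₀` divides the primitive shifted family, so it is a unit
  have hunit : IsUnit C₀ := h.wShift_prim C₀ fun Q => ⟨P Q, hpoly Q⟩
  obtain ⟨c₀, hc₀, hC₀c⟩ := MvPolynomial.isUnit_iff_eq_C_of_isReduced.1 hunit
  exact ⟨c₀, hc₀.ne_zero, fun Q => by rw [hpoly Q, hC₀c]⟩

/-- `rapUni 0` turns the shift into the composition with `T + 1`. [folklore] -/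
theorem rapUni_zero_wShift (F : MvPolynomial ℕ ℂ) :
    rapUni ℂ 0 (substHom 0 (X 0 + 1) F) = (rapUni ℂ 0 F).comp (Polynomial.X + 1) := by
  have : (rapUni ℂ 0).comp (substHom 0 (X 0 + 1 : MvPolynomial ℕ ℂ)).toRingHom =
      (Polynomial.compRingHom (Polynomial.X + 1)).comp (rapUni ℂ 0) := by
    refine ringHom_ext (fun c => ?_) (fun k => ?_)
    · simp [rapUni_C]
    · by_cases hk : k = 0
      · subst hk; simp [rapUni_X_self, map_add]
      · simp [substHom_X_of_ne _ hk, rapUni_X_of_ne hk]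
  exact RingHom.congr_fun this F

/-- **A polynomial with `F(w + 1) = c F(w)`, `c` a constant, does not involve `w`.** [folklore] -/
theorem degreeOf_zero_eq_zero_of_wShift {F : MvPolynomial ℕ ℂ} {c : ℂ} (hF : substHom 0 (X 0 + 1) F = C c * F) :
    F.degreeOf 0 = 0 := by
  set p := rapUni ℂ 0 F with hp
  have hdeg : F.degreeOf 0 = p.natDegree := degreeOf_eq_natDegree_rapUni 0 F
  by_contra hne
  have hp0 : p ≠ 0 := fun h0 => hne (by rw [hdeg, h0, Polynomial.natDegree_zero])
  have hcomp : p.comp (Polynomial.X + 1) = Polynomial.C (genC ℂ c) * p := by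
    rw [hp, ← rapUni_zero_wShift, hF, map_mul, rapUni_C]
  -- leading coefficients: `c = 1`
  have hX1 : (Polynomial.X + 1 : Polynomial (RapidityField ℂ)).natDegree = 1 := by
    rw [show (1 : Polynomial (RapidityField ℂ)) = Polynomial.C 1 from rfl, Polynomial.natDegree_X_add_C]
  have hlc : (Polynomial.X + 1 : Polynomial (RapidityField ℂ)).leadingCoeff = 1 := by
    rw [show (1 : Polynomial (RapidityField ℂ)) = Polynomial.C 1 from rfl, Polynomial.leadingCoeff_X_add_C]
  have hc1 : genC ℂ c = 1 := by
    have := congrArg Polynomial.leadingCoeff hcomp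
    rw [Polynomial.leadingCoeff_comp (by rw [hX1]; exact one_ne_zero), hlc, one_pow, mul_one, Polynomial.leadingCoeff_mul,
      Polynomial.leadingCoeff_C] at this
    exact (mul_left_eq_self₀.1 this.symm).resolve_right (Polynomial.leadingCoeff_ne_zero.2 hp0)
  rw [hc1, map_one, one_mul] at hcomp
  -- `p` is `1`-periodic, hence constant
  have hper : ∀ k : ℕ, p.eval (k : RapidityField ℂ) = p.eval 0 := by
    intro k
    induction k with
    | zero => simp
    | succ k ih =>
      rw [← ih]
      conv_rhs => rw [← hcomp, Polynomial.eval_comp]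
      simp
  have hroots : Set.Infinite {x : RapidityField ℂ | Polynomial.IsRoot (p - Polynomial.C (p.eval 0)) x} := by
    refine Set.infinite_of_injective_forall_mem (f := fun k : ℕ => (k : RapidityField ℂ)) Nat.cast_injective fun k => ?_
    simp [Polynomial.IsRoot, hper k]
  have hpC : p - Polynomial.C (p.eval 0) = 0 := Polynomial.eq_zero_of_infinite_isRoot _ hroots
  have : p.natDegree = 0 := by
    rw [sub_eq_zero.1 hpC, Polynomial.natDegree_C]
  exact hne (by rw [hdeg, this])

/-- **The primitive ground state does not involve `w`.** (IP12/Di Francesco: the ground state of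
`t(w; z⃗)` is independent of the spectral parameter `w`, since it is determined by the qKZ system.)
[cite: IkhlefPonsaing2012, §3.4] -/
theorem degreeOf_zero (hq : q ^ 2 + q + 1 = 0) (h : IsGroundState n q P a) (Q : ColPattern n) : (P Q).degreeOf 0 = 0 := by
  obtain ⟨c, -, hc⟩ := h.exists_wShift_eq_C_mul hq
  exact degreeOf_zero_eq_zero_of_wShift (hc Q)

/-- Hence `Z` is `w`-free. [folklore] -/
theorem wfree (hq : q ^ 2 + q + 1 = 0) (h : IsGroundState n q P a) : (∑ Q, P Q).degreeOf 0 = 0 :=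
  Nat.eq_zero_of_le_zero ((degreeOf_sum_le _ _ _).trans (Finset.sup_le fun Q _ => (h.degreeOf_zero hq Q).le))

end IsGroundState

end WShift

end Literature.Probability.Percolation
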